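import Mathlib
import Summits.ResolutionOfSingularities.ResolutionOfSingularities.Theorems.WeightedInvariantLocalWeightedDropNCResSettingStrict

/-!
# `LocalWeightedDrop`, the NC count game — TOT2-LINE piece S-SET (7): **AT A NEAR POINT THE NEW EQUATION IS THE ACTUAL STRICT TRANSFORM**
# (the (Q4) package for the regime hands)

[OURS · L1 W4.3 · chain w43, engine crux `LocalWeightedDrop` stmt-ResolutionOfSingularities-8899; sub-line under the v32 registered stub
`stub_spaceNCRankDrop`, design memo `L/res-L1-w43-lead-1/g4/TOT2-LINE.md` v1 (Q4) / v1.1 (E), piece S-SET = res-L1-w43-stub-1; objects of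
`…NCResSettingDefs` (p528587), tools of `…NCResSettingStrict` (p529788).  Nothing here is a statement of any manuscript.]

For an admissibly decorated position and a B-permissible move, at an answer `(c, i)` where the ORDER DID NOT DROP (`o' = o`, a near point):
* `Decoration.squarefree_strict_of_o_transform_eq` — the sliced strict transform IS squarefree (else `o' < o`, `order_sqfRep_lt`);
* `Decoration.transform_f_eq_strict_of_o_transform_eq` — so the transform's equation is LITERALLY the sliced strict transform (no radical taken);
* `Decoration.order_strict_eq_of_o_transform_eq` — and its order is exactly `ord f`;
* `Decoration.nearData_of_o_transform_eq` — the package in S-NEAR's hypothesis shape: `(f∘Φ)∘chart = s^{o} · G`, `s ∤ G`, `o ≤ ord (G|_{y_i=0})`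
  with `G = satPart (δ.fChart Φ w c)` and `G|_{y_i=0} = δ.strict Φ w c i = (δ.transform Φ w c i).f`.
Conversely `Decoration.o_transform_eq_of_order_strict` — if the sliced strict transform is squarefree of order `≥ o` then `o' = o`.
-/

set_option linter.dupNamespace false -- mandated namespace of this single-conjunct summit

noncomputable section

namespace Summit.ResolutionOfSingularities.ResolutionOfSingularities.Theorems

namespace TameFourTupleDrop

open MvPowerSeries Literature.AlgebraicGeometry.Resolution

variable {k : Type} [Field k] {m : ℕ}
variable {δ : Decoration k m} {Φ : Fin (m + 1) → MvPowerSeries (Fin (m + 1)) k} {w : Fin (m + 1) → ℕ} {c : Fin (m + 1) → k} {i : Fin (m + 1)}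

/-- At a near point (`o' = o`) the sliced strict transform is SQUAREFREE. -/
theorem Decoration.squarefree_strict_of_o_transform_eq (hperm : IsBPermissible δ Φ w) (hc : ∀ l, w l = 0 → c l = 0) (hf : δ.f ≠ 0)
    (hci : c i ≠ 0) (heq : (δ.transform Φ w c i).o = δ.o) : Squarefree (δ.strict Φ w c i) := by
  by_contra hns
  have hg0 : δ.strict Φ w c i ≠ 0 := Decoration.strict_ne_zero hperm.1 hc hf hci
  have hlt := order_sqfRep_lt hg0 hns
  have hle := Decoration.order_strict_le hperm hc hf hci
  have hfin : δ.f.order ≠ ⊤ := by rw [ne_eq, order_eq_top_iff]; exact hf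
  rw [Decoration.transform_o, Decoration.o] at heq
  have h1 : ((sqfRep (δ.strict Φ w c i)).order.toNat : ℕ∞) < (δ.f.order.toNat : ℕ∞) := by
    rw [ENat.coe_toNat (ne_top_of_lt hlt), ENat.coe_toNat hfin]
    exact hlt.trans_le hle
  rw [heq] at h1
  exact lt_irrefl _ h1

/-- At a near point the transform's equation IS the sliced strict transform (lead-1's (Q4): inside a fundamental unit no radical is taken). -/
theorem Decoration.transform_f_eq_strict_of_o_transform_eq (hperm : IsBPermissible δ Φ w) (hc : ∀ l, w l = 0 → c l = 0) (hf : δ.f ≠ 0)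
    (hci : c i ≠ 0) (heq : (δ.transform Φ w c i).o = δ.o) : (δ.transform Φ w c i).f = δ.strict Φ w c i := by
  rw [Decoration.transform_f, sqfRep_of_squarefree (Decoration.squarefree_strict_of_o_transform_eq hperm hc hf hci heq)]

/-- At a near point the sliced strict transform has order exactly `ord f`. -/
theorem Decoration.order_strict_eq_of_o_transform_eq (hperm : IsBPermissible δ Φ w) (hc : ∀ l, w l = 0 → c l = 0) (hf : δ.f ≠ 0)
    (hci : c i ≠ 0) (heq : (δ.transform Φ w c i).o = δ.o) : (δ.strict Φ w c i).order = δ.f.order := by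
  have hsq := Decoration.squarefree_strict_of_o_transform_eq hperm hc hf hci heq
  have hg0 : δ.strict Φ w c i ≠ 0 := Decoration.strict_ne_zero hperm.1 hc hf hci
  have hfin : δ.f.order ≠ ⊤ := by rw [ne_eq, order_eq_top_iff]; exact hf
  have hgfin : (δ.strict Φ w c i).order ≠ ⊤ := by rw [ne_eq, order_eq_top_iff]; exact hg0
  rw [Decoration.transform_o, Decoration.o, sqfRep_of_squarefree hsq] at heq
  rw [← ENat.coe_toNat hgfin, ← ENat.coe_toNat hfin, heq]

/-- **THE NEAR-POINT PACKAGE** in S-NEAR's hypothesis shape: at an answer where the order did not drop, `(f∘Φ)∘chart_{w,c} = s^{o} · G` with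
`s ∤ G`, `G = satPart (δ.fChart Φ w c)`, and the sliced strict transform `G|_{y_i = 0} = δ.strict Φ w c i` (= the transform's equation) has order
`≥ o` (indeed `= o`). -/
theorem Decoration.nearData_of_o_transform_eq (hperm : IsBPermissible δ Φ w) (hc : ∀ l, w l = 0 → c l = 0) (hf : δ.f ≠ 0)
    (hci : c i ≠ 0) (heq : (δ.transform Φ w c i).o = δ.o) :
    subst (CobordantChart.chart w c) (subst Φ δ.f) = X 0 ^ δ.o * satPart (δ.fChart Φ w c) ∧ ¬ X 0 ∣ satPart (δ.fChart Φ w c) ∧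
      ((δ.o : ℕ) : ℕ∞) ≤ (TupleGame.slice i (satPart (δ.fChart Φ w c))).order := by
  obtain ⟨hfac, hG⟩ := Decoration.fChart_eq (δ := δ) (c := c) hperm.1 hc hf
  have hA := Decoration.satExp_fChart_eq_order hperm hc hf
  have hfin : δ.f.order ≠ ⊤ := by rw [ne_eq, order_eq_top_iff]; exact hf
  have ho : ((δ.o : ℕ) : ℕ∞) = δ.f.order := by rw [Decoration.o, ENat.coe_toNat hfin]
  have hAo : satExp (δ.fChart Φ w c) = δ.o := by
    have h : ((satExp (δ.fChart Φ w c) : ℕ) : ℕ∞) = ((δ.o : ℕ) : ℕ∞) := by rw [hA, ho]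
    exact_mod_cast h
  refine ⟨by rw [← hAo]; exact hfac, hG, ?_⟩
  rw [ho]
  exact (Decoration.order_strict_eq_of_o_transform_eq hperm hc hf hci heq).ge

/-- Conversely: if the sliced strict transform is squarefree and keeps order `≥ ord f`, the order did not drop (`o' = o`). -/
theorem Decoration.o_transform_eq_of_order_strict (hperm : IsBPermissible δ Φ w) (hc : ∀ l, w l = 0 → c l = 0) (hf : δ.f ≠ 0)
    (hci : c i ≠ 0) (hsq : Squarefree (δ.strict Φ w c i)) (hge : δ.f.order ≤ (δ.strict Φ w c i).order) :
    (δ.transform Φ w c i).o = δ.o := by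
  have hord : (δ.strict Φ w c i).order = δ.f.order := le_antisymm (Decoration.order_strict_le hperm hc hf hci) hge
  rw [Decoration.transform_o, Decoration.o, sqfRep_of_squarefree hsq, hord]

end TameFourTupleDrop

end Summit.ResolutionOfSingularities.ResolutionOfSingularities.Theorems

end
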